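import Summits.ResolutionOfSingularities.ResolutionOfSingularities.Theorems.PAlterationPialtReductions
import Literature.AlgebraicGeometry.Resolution.AlterationsCompactification
import Literature.AlgebraicGeometry.Resolution.ChowLemmaProofs
import Literature.AlgebraicGeometry.Motives.VarietiesProperProofs
import HarnessLib

/-!
# `Pialt` (crux stmt-ResolutionOfSingularities-0555): reduction to projective varieties

Companion to `PAlterationPialtKnownCases.lean` / `PAlterationPialtReductions.lean` (landed
`--supports stmt-ResolutionOfSingularities-0555`; does not close the item). The crux `Pialt` is the
positive-characteristic slice of the open Abramovich–Oort conjecture (Temkin 2013, Conj. 1.3.1):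
every integral variety over a field of characteristic `p` has a purely inseparable alteration with
regular source. Here, UNCONDITIONALLY:

* `isPurelyInseparableAlteration_pullback_snd_of_isOpenImmersion` — a purely inseparable
  alteration of `X̄` restricts, over an open `X ⊆ X̄`, to a purely inseparable alteration of `X`
  (finite radicial morphisms are stable under base change; de Jong 1996, 4.7 for alterations);
* `pialtConclusion_of_isOpenImmersion` — hence the conclusion of `Pialt` passes from `X̄` to its
  non-empty opens (an open subscheme of a regular scheme is regular);
* `pialt_iff_forall_isProjectiveOver` — **`Pialt` is equivalent to its restriction to PROJECTIVE
  varieties** (integral `k`-schemes with a closed `k`-immersion into some `ℙⁿ_k`): Chow's lemma in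
  the integral form (`ChowLemmaIntegral_holds`, proved in tree) gives a modification `π : X' → X`
  with an immersion `X' ↪ ℙⁿ_k`; the projective closure `X̄'` of `X'` is a projective variety
  containing `X'` as an open subscheme; a regular purely inseparable alteration of `X̄'` restricts
  to one of `X'` and composes with the proper birational `π` (a purely inseparable alteration,
  `IsBirational.isPurelyInseparableAlteration`, `IsPurelyInseparableAlteration.comp`).

With `pialt_iff_forall_normal` and the known cases, a counterexample to `Pialt`, if any, may be
taken to be an integral projective variety of dimension `≥ 4` (resp. normal of dimension `≥ 4`).

Sources: A. J. de Jong, Publ. Math. IHÉS 83 (1996), 2.20, 4.6–4.7; U. Görtz, T. Wedhorn,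
*Algebraic Geometry I*, 2nd ed., Thm. 13.100 (Chow); M. Temkin, J. Algebra 373 (2013), §1.3.
-/

noncomputable section

set_option linter.dupNamespace false -- mandated namespace of this single-conjunct summit

namespace Summit.ResolutionOfSingularities.ResolutionOfSingularities.Theorems

open CategoryTheory CategoryTheory.Limits AlgebraicGeometry TopologicalSpace
open Literature.AlgebraicGeometry.Resolution
open Summit.ResolutionOfSingularities.ResolutionOfSingularities.Theses.PAlteration (Pialt)

universe u

/-! ## Purely inseparable alterations restrict to opens -/

/-- Universal injectivity over an open `V` of the target passes to any base change:
`X₁' ×_{X̄} X → X` is universally injective over `j⁻¹(V)` if `X₁' → X̄` is over `V`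
(Stacks, Tag 01S4: radicial morphisms are stable under base change). [folklore] -/
theorem universallyInjective_pullback_snd_morphismRestrict {X₁' Xbar X : Scheme.{u}}
    (φ' : X₁' ⟶ Xbar) (j : X ⟶ Xbar) (V : Xbar.Opens) [UniversallyInjective (φ' ∣_ V)] :
    UniversallyInjective (pullback.snd φ' j ∣_ j ⁻¹ᵁ V) := by
  have sq₁ := (isPullback_morphismRestrict (pullback.snd φ' j) (j ⁻¹ᵁ V)).flip
  have sq₂ : IsPullback (pullback.fst φ' j) (pullback.snd φ' j) φ' j :=
    IsPullback.of_hasPullback _ _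
  have big := sq₁.paste_horiz sq₂
  rw [← morphismRestrict_ι] at big
  have sq₃ := (isPullback_morphismRestrict φ' V).flip
  exact MorphismProperty.of_isPullback (big.of_right' sq₃) inferInstance

/-- **A purely inseparable alteration stays one after base change along an open immersion with
non-empty source**: for `φ̄ : X̄₁ → X̄` a purely inseparable alteration of the integral `X̄` and
`j : X → X̄` an open immersion with `X` non-empty, `X̄₁ ×_{X̄} X → X` is a purely inseparable
alteration (de Jong 1996, 4.7 for alterations: `IsAlteration.pullback_snd_of_isOpenImmersion`;
plus base change of radiciality over the dense open, which meets `j(X)`).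
[cite: DeJong1996, 4.7, p. 67] -/
theorem isPurelyInseparableAlteration_pullback_snd_of_isOpenImmersion {X₁' Xbar X : Scheme.{u}}
    (φ' : X₁' ⟶ Xbar) (j : X ⟶ Xbar) [IsOpenImmersion j] [IsIntegral Xbar] [Nonempty X]
    (h : IsPurelyInseparableAlteration φ') : IsPurelyInseparableAlteration (pullback.snd φ' j) := by
  have hA := h.isAlteration.pullback_snd_of_isOpenImmersion φ' j
  refine ⟨hA.isIntegral, hA.isProper, hA.isDominant, ?_⟩
  obtain ⟨V, hV, hfin, hui⟩ := h.exists_isFinite_universallyInjective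
  haveI := hfin
  haveI := hui
  refine ⟨j ⁻¹ᵁ V, ?_, isFinite_pullback_snd_morphismRestrict φ' j V,
    universallyInjective_pullback_snd_morphismRestrict φ' j V⟩
  -- `V` meets the non-empty open `j(X)` of the irreducible `X̄`
  have hjX : (j.opensRange : Set Xbar).Nonempty := by
    obtain ⟨x⟩ := ‹Nonempty X›
    exact ⟨j x, x, rfl⟩
  obtain ⟨_, ⟨x, rfl⟩, hxV⟩ := (j.opensRange.isOpen.dense hjX).exists_mem_open V.isOpen hV
  exact ⟨x, hxV⟩

/-- **The conclusion of `Pialt` passes to non-empty open subschemes**: if `j : X → X̄` is an open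
immersion of integral schemes and `X̄` has a proper surjective `ḡ : Ȳ → X̄` with `Ȳ` integral
regular, finite and universally injective over a dense open, then so has `X` — restrict `ḡ` over
`X` (`isPurelyInseparableAlteration_pullback_snd_of_isOpenImmersion`; an open subscheme of a regular
scheme is regular). [folklore] -/
theorem pialtConclusion_of_isOpenImmersion {X Xbar : Scheme.{u}} [IsIntegral X] [IsIntegral Xbar]
    (j : X ⟶ Xbar) [IsOpenImmersion j]
    (h : ∃ (Y : Scheme.{u}) (g : Y ⟶ Xbar), IsProper g ∧ IsIntegral Y ∧ Scheme.IsRegular Y ∧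
      Function.Surjective g.base ∧ ∃ U : Xbar.Opens, Dense (U : Set Xbar) ∧ IsFinite (g ∣_ U) ∧
        UniversallyInjective (g ∣_ U)) :
    ∃ (Y : Scheme.{u}) (g : Y ⟶ X), IsProper g ∧ IsIntegral Y ∧ Scheme.IsRegular Y ∧
      Function.Surjective g.base ∧ ∃ U : X.Opens, Dense (U : Set X) ∧ IsFinite (g ∣_ U) ∧
        UniversallyInjective (g ∣_ U) := by
  obtain ⟨Y, g, hprop, hint, hreg, hsurj, U, hU, hfin, hui⟩ := h
  haveI := hprop
  haveI := hint
  have hpi : IsPurelyInseparableAlteration g :=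
    ⟨hint, hprop, ⟨hsurj.denseRange⟩, U, hU.nonempty, hfin, hui⟩
  have hpi' := isPurelyInseparableAlteration_pullback_snd_of_isOpenImmersion g j hpi
  have hreg' : Scheme.IsRegular (pullback g j) :=
    Scheme.IsRegular.of_isOpenImmersion (pullback.fst g j) hreg
  haveI := hpi'.isIntegral
  haveI := hpi'.isProper
  haveI : Surjective g := ⟨hsurj⟩
  obtain ⟨V, hV, hfinV, huiV⟩ := hpi'.exists_isFinite_universallyInjective
  exact ⟨pullback g j, pullback.snd g j, hpi'.isProper, hpi'.isIntegral, hreg',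
    (pullback.snd g j).surjective, V, V.2.dense hV, hfinV, huiV⟩

/-! ## Projective varieties are separated of finite type -/

/-- A projective `k`-scheme (closed `k`-immersion into some `ℙⁿ_k`) is proper over `k`; in
particular separated, quasi-compact and locally of finite type. [folklore] -/
theorem isProper_of_isProjectiveOver {k : Type u} [Field k] {X : Scheme.{u}}
    (f : X ⟶ Spec (.of k))
    (h : Literature.AlgebraicGeometry.Motives.IsProjectiveOver (Over.mk f)) : IsProper f := by
  obtain ⟨n, ι, hι⟩ := h
  have h₁ : IsProper ι.left := inferInstance
  have h₂ : IsProper (Literature.AlgebraicGeometry.Motives.projectiveSpace n k).hom :=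
    Literature.AlgebraicGeometry.Motives.isProper_projectiveSpace n k
  have h₃ : IsProper (ι.left ≫ (Literature.AlgebraicGeometry.Motives.projectiveSpace n k).hom) :=
    inferInstance
  have hw : ι.left ≫ (Literature.AlgebraicGeometry.Motives.projectiveSpace n k).hom = f :=
    Over.w ι
  rwa [hw] at h₃

/-! ## Reduction of `Pialt` to projective varieties -/

/-- **The conclusion of `Pialt` for one variety follows from `Pialt` for projective varieties
over the same field** (de Jong 1996, 4.6–4.7, purely inseparable version): Chow's lemma
(`ChowLemmaIntegral_holds`) gives a proper birational `π : X' → X` from an integral `X'` with an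
immersion `ι : X' → ℙⁿ_k` over `k`; the scheme-theoretic image `X̄'` of `ι` is an integral
projective `k`-variety and `X' → X̄'` is an open immersion (Mathlib, for the quasi-compact
immersion `ι`); a regular purely inseparable alteration of `X̄'` restricts to one of `X'`
(`pialtConclusion_of_isOpenImmersion`) and descends along the purely inseparable alteration `π`
(`pialtConclusion_of_isPurelyInseparableAlteration`). [cite: DeJong1996, 4.6–4.7, pp. 66–67] -/
theorem pialtConclusion_of_forall_isProjectiveOver {k : Type} [Field k] {X : Scheme.{0}}
    (f : X ⟶ Spec (.of k)) [IsSeparated f] [LocallyOfFiniteType f] [QuasiCompact f] [IsIntegral X]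
    (H : ∀ (X' : Scheme.{0}) (f' : X' ⟶ Spec (.of k)), IsIntegral X' →
      Literature.AlgebraicGeometry.Motives.IsProjectiveOver (Over.mk f') →
        ∃ (Y : Scheme.{0}) (g : Y ⟶ X'), IsProper g ∧ IsIntegral Y ∧ Scheme.IsRegular Y ∧
          Function.Surjective g.base ∧ ∃ U : X'.Opens, Dense (U : Set X') ∧ IsFinite (g ∣_ U) ∧
            UniversallyInjective (g ∣_ U)) :
    ∃ (Y : Scheme.{0}) (g : Y ⟶ X), IsProper g ∧ IsIntegral Y ∧ Scheme.IsRegular Y ∧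
      Function.Surjective g.base ∧ ∃ U : X.Opens, Dense (U : Set X) ∧ IsFinite (g ∣_ U) ∧
        UniversallyInjective (g ∣_ U) := by
  obtain ⟨n, X', π, ι, hX', hι, hπ, hsurj, hcomm, U, hU, hU', hiso⟩ :=
    ChowLemmaIntegral_holds.{0} k X f ‹_› ‹_› ‹_› ‹_›
  haveI := hX'
  haveI := hι
  haveI := hπ
  haveI := hsurj
  haveI := hiso
  -- `π` is proper birational, hence a purely inseparable alteration
  have hπpi : IsPurelyInseparableAlteration π :=
    IsBirational.isPurelyInseparableAlteration ⟨U, hU, hU', hiso⟩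
  apply pialtConclusion_of_isPurelyInseparableAlteration hπpi
  -- the projective closure of `X'` in `ℙⁿ_k`
  let P := Literature.AlgebraicGeometry.Motives.projectiveSpace n k
  haveI : IsProper P.hom := Literature.AlgebraicGeometry.Motives.isProper_projectiveSpace n k
  haveI : QuasiCompact (ι ≫ P.hom) := by rw [hcomm]; infer_instance
  haveI : QuasiCompact ι := QuasiCompact.of_comp ι P.hom
  haveI : IsIntegral ι.image := ChowLemmaProof.isIntegral_image ι
  apply pialtConclusion_of_isOpenImmersion ι.toImage
  apply H ι.image (ι.imageι ≫ P.hom) inferInstance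
  exact ⟨n, Over.homMk ι.imageι rfl, inferInstanceAs (IsClosedImmersion ι.imageι)⟩

/-- **Reduction of `Pialt` to projective varieties**: `Pialt` is equivalent to its restriction to
integral PROJECTIVE `k`-schemes (closed `k`-immersion into some `ℙⁿ_k`;
`Literature.AlgebraicGeometry.Motives.IsProjectiveOver`), for every field `k` of characteristic
`p` — by Chow's lemma, projective closure, restriction of purely inseparable alterations to opens
and composition with the Chow modification (`pialtConclusion_of_forall_isProjectiveOver`). So a
counterexample to `Pialt`, if any, may be taken projective. [cite: DeJong1996, 4.6–4.7] -/
theorem pialt_iff_forall_isProjectiveOver :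
    Pialt ↔ ∀ p : ℕ, p.Prime → ∀ (k : Type) [Field k] [CharP k p] (X : Scheme.{0})
      (f : X ⟶ Spec (.of k)), IsIntegral X →
        Literature.AlgebraicGeometry.Motives.IsProjectiveOver (Over.mk f) →
          ∃ (X' : Scheme.{0}) (g : X' ⟶ X), IsProper g ∧ IsIntegral X' ∧ Scheme.IsRegular X' ∧
            Function.Surjective g.base ∧ ∃ U : X.Opens, Dense (U : Set X) ∧ IsFinite (g ∣_ U) ∧
              UniversallyInjective (g ∣_ U) := by
  refine ⟨fun h p hp k _ _ X f hi hproj => ?_, fun h => ?_⟩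
  · unfold Pialt at h
    haveI := isProper_of_isProjectiveOver f hproj
    exact h p hp k X f inferInstance inferInstance inferInstance hi
  · unfold Pialt
    intro p hp k _ _ X f hs hl hq hi
    haveI := hs; haveI := hl; haveI := hq; haveI := hi
    exact pialtConclusion_of_forall_isProjectiveOver f fun X' f' hi' hproj => h p hp k X' f' hi' hproj

end Summit.ResolutionOfSingularities.ResolutionOfSingularities.Theorems

end
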